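import Literature.NumberTheory.Sieve.GreenTao2008Majorant
import Literature.NumberTheory.Sieve.GreenTao2008SelbergMainTerm
import Literature.NumberTheory.Sieve.GreenTao2008CorrelationComparison
import Literature.NumberTheory.Sieve.SmoothMajorantAssembly
import HarnessLib

/-!
# Green–Tao (2008), Proposition 9.5 (Goldston–Yıldırım linear forms estimate): the discharge

Everything in this file is PROVED. It assembles the elementary proof of
`Literature.NumberTheory.Sieve.GreenTao2008.GoldstonYildirimLinearForms` (B. Green, T. Tao, Ann. of Math. 167 (2008),
Proposition 9.5), replacing §10 and Appendix A of the source (Euler products and a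
`2m`-variable contour integral against `ζ`, Lemmas 10.3, 10.4, A.1–A.3) by:

1. the source's own reductions (10.1)–(10.3) — expansion of the squares, passage from the box to
   `ℤ_D^t` with error `O(R^{-8m})`, Chinese remainder theorem — in the form proved in the tree's
   `SmoothMajorant{Local,CRT,Density,Assembly}` files (`CFZ.expect_prod_sq_divSum_eq`,
   `CFZ.abs_sum_coef_mul_expect_sub_tupleDensity_le`, `CFZ.tupleDensity_eq_prod_localDensity`) and
   Lemma 10.1 (local factors; `CFZ.localDensity_singleton`, `CFZ.localDensity_le_of_minor`), which
   turn `E(∏_i Λ_R(θ_i(x))² | x ∈ B)` into the correlation sum `T(ω)` of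
   `GreenTao2008CorrelationComparison` for the local density system `ω_p = ω_·(p)` of the forms;
2. the comparison `T(ω) = S_W(R)^m + O((C log R)^m (W/φ W)^{2m} 16^m / w)`
   (`abs_correlationSum_sub_pow_le`), `S_W(R)` the `m = 1` Selberg form;
3. the `m = 1` asymptotic `S_W(R) = (1 + o(1)) (W/φ(W)) log R` for `w` slowly growing
   (`selbergS_primorial_asymptotic`, by Selberg's diagonalisation and `∑ μ(n)log(u/n)/n → 1`,
   ultimately the tree's `M(x) ≪ x e^{-c√log x}`).

The growth bound is `G(N) = ⌊log log log R⌋` (`R = N^{k⁻¹2^{-k-4}}`), which guarantees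
`exp(exp(w(N))) ≤ log R`; any slower `w → ∞` is admissible, as the statement requires.

## References

* B. Green, T. Tao, *The primes contain arbitrarily long arithmetic progressions*, Ann. of Math.
  167 (2008), 481–547: Proposition 9.5 (p. 525), §10 pp. 530–535, Lemma 10.1. [cite: GreenTaoAnnals2008]
-/

noncomputable section

open Real Finset Filter ArithmeticFunction Topology
open scoped ArithmeticFunction.Moebius BigOperators

namespace Literature.NumberTheory.Sieve.GreenTao2008

open Literature.NumberTheory.Sieve.CFZ

/-! ### `Λ_R` as a normalised divisor sum -/

/-- The normalised coefficient `c(d) = μ(d) (log(R/d)/log R)` clamped to `[-1, 1]` (equal to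
`μ(d) log(R/d)/log R` for `1 ≤ d ≤ R`). [cite: GreenTaoAnnals2008, Definition 9.2] -/
def gyNormCoeff (R : ℝ) (d : ℕ) : ℝ := (μ d : ℝ) * max 0 (min 1 (Real.log (R / d) / Real.log R))

/-- `|c(d)| ≤ 1`. [folklore] -/
theorem abs_gyNormCoeff_le (R : ℝ) (d : ℕ) : |gyNormCoeff R d| ≤ 1 := by
  unfold gyNormCoeff
  rw [abs_mul]
  have h1 : |(μ d : ℝ)| ≤ 1 := by exact_mod_cast ArithmeticFunction.abs_moebius_le_one
  have h2 : |max 0 (min 1 (Real.log (R / d) / Real.log R))| ≤ 1 := by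
    rw [abs_of_nonneg (le_max_left _ _)]
    exact max_le zero_le_one (min_le_left _ _)
  calc |(μ d : ℝ)| * |max 0 (min 1 (Real.log (R / d) / Real.log R))| ≤ 1 * 1 :=
        mul_le_mul h1 h2 (abs_nonneg _) zero_le_one
    _ = 1 := one_mul 1

/-- `c(d) = 0` off the square-free numbers. [folklore] -/
theorem gyNormCoeff_eq_zero_of_not_squarefree (R : ℝ) {d : ℕ} (hd : ¬Squarefree d) : gyNormCoeff R d = 0 := by
  rw [gyNormCoeff, ArithmeticFunction.moebius_eq_zero_of_not_squarefree hd]; simp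

/-- For `1 ≤ d ≤ R`, `R > 1`: `c(d) log R = μ(d) log(R/d)`. [cite: GreenTaoAnnals2008, Definition 9.2] -/
theorem gyNormCoeff_mul_log {R : ℝ} (hR : 1 < R) {d : ℕ} (hd : d ∈ Finset.Icc 1 ⌊R⌋₊) :
    gyNormCoeff R d * Real.log R = gyCoeff R d := by
  have hR0 : 0 < R := by linarith
  have hlog : 0 < Real.log R := Real.log_pos hR
  have hd1 : (1 : ℝ) ≤ d := by exact_mod_cast (Finset.mem_Icc.1 hd).1
  have hdR : (d : ℝ) ≤ R := (Nat.cast_le.2 (Finset.mem_Icc.1 hd).2).trans (Nat.floor_le hR0.le)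
  have h0 : 0 ≤ Real.log (R / d) / Real.log R :=
    div_nonneg (Real.log_nonneg ((one_le_div (by linarith)).2 hdR)) hlog.le
  have h1 : Real.log (R / d) / Real.log R ≤ 1 := by
    rw [div_le_one hlog, Real.log_div hR0.ne' (by linarith)]
    linarith [Real.log_nonneg hd1]
  rw [gyNormCoeff, gyCoeff, max_eq_right (le_min zero_le_one h0), min_eq_right h1]
  field_simp

/-- **`Λ_R(n) = log R · ∑_{d ≤ R, d ∣ n} c(d)`** (`R > 1`). [cite: GreenTaoAnnals2008, Definition 9.2] -/
theorem truncatedDivisorSum_eq_log_mul_divSum_gyNormCoeff {R : ℝ} (hR : 1 < R) (n : ℤ) :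
    truncatedDivisorSum R n = Real.log R * divSum (gyNormCoeff R) R n := by
  rw [truncatedDivisorSum, divSum, mul_sum]
  refine sum_congr rfl fun d hd => ?_
  rw [mul_comm (Real.log R), gyNormCoeff_mul_log hR (mem_filter.1 hd).1, gyCoeff]

/-! ### The local densities of the forms are a local density system (Lemma 10.1) -/

/-- **Green–Tao, Lemma 10.1** for the densities `ω_p(X) = E_{ℤ_p^t}[θ_i ≡ 0 ∀ i ∈ X]` of the
forms `θ_i = W(∑_j L_{ij} x_j + b_i) + 1`, `W = ∏_{p ≤ w} p`: with `|L_{ij}| ≤ C`, `2C² ≤ w`, rows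
nonzero and pairwise non-proportional, they form an `IsLocalDensitySystem` at the primes `≤ R`.
[cite: GreenTaoAnnals2008, Lemma 10.1] -/
theorem isLocalDensitySystem_localDensity {m n w : ℕ} (R : ℝ) (L : Fin m → Fin (n + 1) → ℤ)
    {C : ℕ} (hLC : ∀ i j, |L i j| ≤ C) (hCw : 2 * C ^ 2 ≤ w) (hL0 : ∀ i, L i ≠ 0)
    (hLp : ∀ i i', i ≠ i' → ∀ c : ℚ, (fun j => (L i j : ℚ)) ≠ c • fun j => (L i' j : ℚ)) (b : Fin m → ℤ) :
    IsLocalDensitySystem m R (primorial w) (fun p X => localDensity₀ p (primorial w) L b X) where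
  empty p := localDensity₀_empty p _ L b
  dvd p hp hpW X hX := by
    haveI : Fact p.Prime := ⟨prime_of_mem_primesUpTo hp⟩
    haveI : NeZero p := ⟨(prime_of_mem_primesUpTo hp).ne_zero⟩
    rw [localDensity₀_eq]
    exact localDensity_eq_zero_of_dvd hpW L b hX
  singleton p hp hpW i := by
    have hpr := prime_of_mem_primesUpTo hp
    haveI : Fact p.Prime := ⟨hpr⟩
    haveI : NeZero p := ⟨hpr.ne_zero⟩
    have hpw : w < p := lt_of_not_ge fun h => hpW ((hpr.dvd_primorial_iff).2 h)
    have hpC : 2 * C ^ 2 < p := lt_of_le_of_lt hCw hpw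
    obtain ⟨j, hj⟩ : ∃ j, (L i j : ZMod p) ≠ 0 := by
      obtain ⟨j, hj⟩ : ∃ j, L i j ≠ 0 := by
        by_contra h; push Not at h; exact hL0 i (funext h)
      refine ⟨j, fun h0 => hj ?_⟩
      rw [ZMod.intCast_zmod_eq_zero_iff_dvd] at h0
      have hlt : |L i j| < p := by
        calc |L i j| ≤ C := hLC i j
          _ ≤ 2 * (C : ℤ) ^ 2 := by nlinarith
          _ < p := by exact_mod_cast hpC
      exact Int.eq_zero_of_abs_lt_dvd h0 hlt
    rw [localDensity₀_eq]
    exact localDensity_singleton hpW L b i hj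
  two_le p hp hpW X hX := by
    have hpr := prime_of_mem_primesUpTo hp
    haveI : Fact p.Prime := ⟨hpr⟩
    haveI : NeZero p := ⟨hpr.ne_zero⟩
    have hpw : w < p := lt_of_not_ge fun h => hpW ((hpr.dvd_primorial_iff).2 h)
    have hpC : 2 * C ^ 2 < p := lt_of_le_of_lt hCw hpw
    refine ⟨(localDensity₀_nonneg_le_one p _ L b X).1, ?_⟩
    obtain ⟨i, hi, i', hi', hii'⟩ := one_lt_card.1 (lt_of_lt_of_le one_lt_two hX)
    obtain ⟨j₀, j₁, hj, hM, hMB⟩ := exists_minor_ne_zero (L i) (L i') (hL0 i') (hLp i i' hii')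
      (B := C) (hLC i) (hLC i')
    have hM' : ((L i j₀ * L i' j₁ - L i j₁ * L i' j₀ : ℤ) : ZMod p) ≠ 0 := by
      exact_mod_cast intCast_minor_ne_zero hM hMB hpC
    rw [localDensity₀_eq]
    exact localDensity_le_of_minor hpW L b hi hi' hj hM'

/-! ### From the box average to the correlation sum -/

/-- The sum over tuples of `(∏ c) · tupleDensity` is the normalised correlation sum
`(log R)^{-2m} T(ω)`. [cite: GreenTaoAnnals2008, Section 10 eq. (10.2)–(10.3)] -/
theorem sum_coef_tupleDensity_eq {m t : ℕ} {R : ℝ} (hR : 1 < R) (W : ℕ) (L : Fin m → Fin t → ℤ) (b : Fin m → ℤ) :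
    ∑ dd ∈ Fintype.piFinset (fun _ : Fin m ⊕ Fin m => Finset.Icc 1 ⌊R⌋₊),
      (∏ v, gyNormCoeff R (dd v)) * tupleDensity W L b (fun j => dd (Sum.inl j)) (fun j => dd (Sum.inr j)) =
      (Real.log R ^ (2 * m))⁻¹ * correlationSum m R (fun p X => localDensity₀ p W L b X) := by
  classical
  have hlog : 0 < Real.log R := Real.log_pos hR
  rw [correlationSum, tupleBox, mul_sum]
  refine sum_congr rfl fun dd hdd => ?_
  rw [Fintype.mem_piFinset] at hdd
  have hc : ∀ v, gyNormCoeff R (dd v) = (Real.log R)⁻¹ * gyCoeff R (dd v) := fun v => by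
    rw [← gyNormCoeff_mul_log hR (hdd v)]; field_simp
  have hprod : (∏ v, gyNormCoeff R (dd v)) = (Real.log R ^ (2 * m))⁻¹ * ∏ v, gyCoeff R (dd v) := by
    rw [Fintype.prod_congr _ _ hc, prod_mul_distrib, prod_const, card_univ, Fintype.card_sum, Fintype.card_fin,
      inv_pow, two_mul]
  by_cases hsq : ∀ v, Squarefree (dd v)
  · have hP : ∀ p ∈ primesUpTo R, p.Prime := fun p hp => prime_of_mem_primesUpTo hp
    have hmem : ∀ v, dd v ∈ squarefreeOf (primesUpTo R) := fun v =>
      (mem_squarefreeOf hP).2 ⟨hsq v, primeFactors_subset_primesUpTo (hdd v)⟩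
    rw [tupleDensity_eq_prod_localDensity W L b hP (fun j => hmem _) (fun j => hmem _), hprod, tupleWeight]
    rw [mul_assoc]
    congr 2
    exact prod_congr rfl fun p _ => by rw [projPattern_pattern]
  · push Not at hsq
    obtain ⟨v, hv⟩ := hsq
    have h1 : (∏ v, gyNormCoeff R (dd v)) = 0 :=
      prod_eq_zero (mem_univ v) (gyNormCoeff_eq_zero_of_not_squarefree R hv)
    have h2 : (∏ v, gyCoeff R (dd v)) = 0 := by
      refine prod_eq_zero (mem_univ v) ?_
      rw [gyCoeff, ArithmeticFunction.moebius_eq_zero_of_not_squarefree hv]; simp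
    rw [h1, h2]; simp

/-- **(10.1)–(10.3): the box average against the correlation sum**: for `R > 1` and a box with
sides `ℓ_j ≥ R^{2m}`,
`|E_{x∈B} ∏_i Λ_R(θ_i(x))² - T(ω)| ≤ (log R)^{2m} R^{2m} ∑_j R^{2m}/ℓ_j`. [cite: GreenTaoAnnals2008, Section 10 eq. (10.1)–(10.3)] -/
theorem abs_expect_sub_correlationSum_le {m t : ℕ} {R : ℝ} (hR : 1 < R) (W : ℕ) (L : Fin m → Fin t → ℤ)
    (b : Fin m → ℤ) (a : Fin t → ℤ) (ℓ : Fin t → ℕ) (hℓ : ∀ j, R ^ (2 * m) ≤ ℓ j) :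
    |(𝔼 x ∈ Fintype.piFinset (fun j => Ico (a j) (a j + ℓ j)),
        ∏ i, truncatedDivisorSum R (W * (∑ j, L i j * x j + b i) + 1) ^ 2) -
      correlationSum m R (fun p X => localDensity₀ p W L b X)| ≤
      Real.log R ^ (2 * m) * (R ^ (2 * m) * ∑ j, R ^ (2 * m) / ℓ j) := by
  classical
  have hlog : 0 < Real.log R := Real.log_pos hR
  -- `Λ_R(θ_i x) = log R · divSum c R (wForm W (L i) (b i) x)`
  have hform : ∀ x : Fin t → ℤ, ∏ i, truncatedDivisorSum R (W * (∑ j, L i j * x j + b i) + 1) ^ 2 =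
      ∏ i, (Real.log R * divSum (gyNormCoeff R) R (wForm W (L i) (b i) x)) ^ 2 := by
    intro x
    exact Fintype.prod_congr _ _ fun i => by rw [wForm_int, truncatedDivisorSum_eq_log_mul_divSum_gyNormCoeff hR]
  rw [expect_congr rfl fun x _ => hform x, expect_prod_sq_divSum_eq]
  have herr := abs_sum_coef_mul_expect_sub_tupleDensity_le (gyNormCoeff R) (abs_gyNormCoeff_le R)
    (fun d hd => gyNormCoeff_eq_zero_of_not_squarefree R hd) hR.le W L b a ℓ hℓ
  have hmain := sum_coef_tupleDensity_eq (t := t) hR W L b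
  -- `K^{2m} ∑ (∏c) E_B = K^{2m} (∑ (∏c)(E_B - density) + ∑ (∏c) density)`
  set Sbox := ∑ dd ∈ Fintype.piFinset (fun _ : Fin m ⊕ Fin m => Finset.Icc 1 ⌊R⌋₊),
    (∏ v, gyNormCoeff R (dd v)) * 𝔼 x ∈ Fintype.piFinset (fun j => Ico (a j) (a j + ℓ j)),
      (if ∀ j, ((dd (Sum.inl j) : ℤ) ∣ wForm W (L j) (b j) x) ∧ ((dd (Sum.inr j) : ℤ) ∣ wForm W (L j) (b j) x)
        then (1 : ℝ) else 0) with hSbox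
  set Sden := ∑ dd ∈ Fintype.piFinset (fun _ : Fin m ⊕ Fin m => Finset.Icc 1 ⌊R⌋₊),
    (∏ v, gyNormCoeff R (dd v)) * tupleDensity W L b (fun j => dd (Sum.inl j)) (fun j => dd (Sum.inr j)) with hSden
  have hsplit : Sbox - Sden = ∑ dd ∈ Fintype.piFinset (fun _ : Fin m ⊕ Fin m => Finset.Icc 1 ⌊R⌋₊),
      (∏ v, gyNormCoeff R (dd v)) *
        ((𝔼 x ∈ Fintype.piFinset (fun j => Ico (a j) (a j + ℓ j)),
          (if ∀ j, ((dd (Sum.inl j) : ℤ) ∣ wForm W (L j) (b j) x) ∧ ((dd (Sum.inr j) : ℤ) ∣ wForm W (L j) (b j) x)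
            then (1 : ℝ) else 0)) -
          tupleDensity W L b (fun j => dd (Sum.inl j)) (fun j => dd (Sum.inr j))) := by
    rw [hSbox, hSden, ← sum_sub_distrib]
    exact sum_congr rfl fun dd _ => by ring
  have hK : Real.log R ^ (2 * m) * Sden = correlationSum m R (fun p X => localDensity₀ p W L b X) := by
    rw [hmain, ← mul_assoc, mul_inv_cancel₀ (pow_ne_zero _ hlog.ne'), one_mul]
  rw [← hK, ← mul_sub, abs_mul, abs_of_pos (pow_pos hlog _), hsplit]
  exact mul_le_mul_of_nonneg_left herr (pow_pos hlog _).le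

/-! ### Two elementary inequalities -/

/-- `|x - 1| ≤ δ ≤ 1 ⟹ |x^m - 1| ≤ (2^m - 1) δ`. [folklore] -/
theorem abs_pow_sub_one_le_of_abs_sub_one_le {x δ : ℝ} (hx : |x - 1| ≤ δ) (hδ : δ ≤ 1) (m : ℕ) :
    |x ^ m - 1| ≤ (2 ^ m - 1) * δ := by
  have hδ0 : 0 ≤ δ := (abs_nonneg _).trans hx
  have hxa : |x| ≤ 2 := by
    calc |x| = |(x - 1) + 1| := by ring_nf
      _ ≤ |x - 1| + |(1 : ℝ)| := abs_add_le _ _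
      _ ≤ δ + 1 := by rw [abs_one]; linarith
      _ ≤ 2 := by linarith
  induction m with
  | zero => simp
  | succ k ih =>
    have hid : x ^ (k + 1) - 1 = x * (x ^ k - 1) + (x - 1) := by ring
    rw [hid]
    have h2k : (0 : ℝ) ≤ 2 ^ k - 1 := by
      have : (1 : ℝ) ≤ 2 ^ k := one_le_pow₀ (by norm_num)
      linarith
    calc |x * (x ^ k - 1) + (x - 1)| ≤ |x * (x ^ k - 1)| + |x - 1| := abs_add_le _ _
      _ = |x| * |x ^ k - 1| + |x - 1| := by rw [abs_mul]
      _ ≤ 2 * ((2 ^ k - 1) * δ) + δ :=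
          add_le_add (mul_le_mul hxa ih (abs_nonneg _) (by norm_num)) hx
      _ = (2 ^ (k + 1) - 1) * δ := by ring

/-- `E_1(W) = W/φ(W) ≤ e⁵ log w` for `W = ∏_{p ≤ w} p`, `w ≥ 2` (Mertens). [folklore] -/
theorem eulerFactorProd_primorial_le_log {w : ℕ} (hw : 2 ≤ w) :
    eulerFactorProd 1 (primorial w).primeFactors ≤ Real.exp 5 * Real.log w := by
  rw [primeFactors_primorial]
  exact eulerFactorProd_primesBelow_le_log hw

/-! ### The estimate at a single level -/

/-- `∑_j R^{2m}/ℓ_j ≤ (n+1) R^{2m}/R^{10m}` for sides `ℓ_j ≥ R^{10m}`. [folklore] -/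
theorem gy_sum_div_sides_le {m n : ℕ} {R : ℝ} (hR : 1 ≤ R) (ℓ : Fin (n + 1) → ℕ) (hℓ : ∀ j, R ^ (10 * m) ≤ ℓ j) :
    ∑ j, R ^ (2 * m) / (ℓ j : ℝ) ≤ (n + 1) * (R ^ (2 * m) / R ^ (10 * m)) := by
  have hR10 : 0 < R ^ (10 * m) := by positivity
  calc ∑ j, R ^ (2 * m) / (ℓ j : ℝ) ≤ ∑ _j : Fin (n + 1), R ^ (2 * m) / R ^ (10 * m) :=
        sum_le_sum fun j _ => div_le_div_of_nonneg_left (by positivity) hR10 (hℓ j)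
    _ = (n + 1) * (R ^ (2 * m) / R ^ (10 * m)) := by
        rw [sum_const, card_univ, Fintype.card_fin, nsmul_eq_mul]; push_cast; ring

/-- **Proposition 9.5 at a single level `R`, explicit.** For `W = ∏_{p ≤ w} p` with `w ≥ 16^m`,
`w ≥ 2`, a level `R ≥ 2`, a system `L` with `|L_{ij}| ≤ C`, `2C² ≤ w`, nonzero pairwise
non-proportional rows, any shifts `b` and any box of sides `ℓ_j ≥ R^{10m}`, and given the `m = 1`
relative error `|S_W(R)/((W/φ W) log R) - 1| ≤ δ ≤ 1`:
`|E(∏_i Λ_R(θ_i)² | B)/(W log R/φ(W))^m - 1| ≤ 2(16 C₀² e⁵ · e⁵ log w)^m / w + (2^m - 1)δ + (n+1)(log R)^m/R^{6m}`.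
[cite: GreenTaoAnnals2008, Proposition 9.5] -/
theorem linearForms_core {m n w : ℕ} {R δ C₀ : ℝ} (hC₀ : ∀ u, |moebiusLogSum u| ≤ C₀)
    (hR : 2 ≤ R) (hw2 : 2 ≤ w) (hw16 : (16 : ℝ) ^ m ≤ w)
    (hδ : |selbergS (primorial w) R / ((primorial w : ℝ) / ((primorial w).totient : ℝ) * Real.log R) - 1| ≤ δ)
    (hδ1 : δ ≤ 1)
    (L : Fin m → Fin (n + 1) → ℤ) {C : ℕ} (hLC : ∀ i j, |L i j| ≤ C) (hCw : 2 * C ^ 2 ≤ w) (hL0 : ∀ i, L i ≠ 0)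
    (hLp : ∀ i i', i ≠ i' → ∀ c : ℚ, (fun j => (L i j : ℚ)) ≠ c • fun j => (L i' j : ℚ))
    (b : Fin m → ℤ) (a : Fin (n + 1) → ℤ) (ℓ : Fin (n + 1) → ℕ) (hℓ : ∀ j, R ^ (10 * m) ≤ ℓ j) :
    |(𝔼 x ∈ Fintype.piFinset (fun j => Ico (a j) (a j + ℓ j)),
        ∏ i, truncatedDivisorSum R (primorial w * (∑ j, L i j * x j + b i) + 1) ^ 2) /
        ((primorial w : ℝ) * Real.log R / ((primorial w).totient : ℝ)) ^ m - 1| ≤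
      2 * (16 * C₀ ^ 2 * Real.exp 5 * (Real.exp 5 * Real.log w)) ^ m / w + (2 ^ m - 1) * δ +
        (n + 1) * Real.log R ^ m / R ^ (6 * m) := by
  classical
  have hC0 : 0 ≤ C₀ := (abs_nonneg _).trans (hC₀ 0)
  have hR1 : 1 < R := by linarith
  have hR1' : 1 ≤ R := hR1.le
  have hR0 : 0 < R := by linarith
  have hW0 : primorial w ≠ 0 := primorial_ne_zero w
  have hEW1 : 1 ≤ eulerFactorProd 1 (primorial w).primeFactors :=
    one_le_eulerFactorProd one_pos (primeFactors_prime _)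
  have hLg0 : 0 < Real.log R := Real.log_pos hR1
  have hw0 : (0 : ℝ) < w := by exact_mod_cast (by omega : 0 < w)
  have hδ0 : 0 ≤ δ := (abs_nonneg _).trans hδ
  -- names (opaque from here on)
  obtain ⟨W, hW⟩ : ∃ W', primorial w = W' := ⟨_, rfl⟩
  obtain ⟨EW, hEWdef⟩ : ∃ E', eulerFactorProd 1 (primorial w).primeFactors = E' := ⟨_, rfl⟩
  obtain ⟨Lg, hLgdef⟩ : ∃ L', Real.log R = L' := ⟨_, rfl⟩
  rw [hW] at hW0
  rw [hEWdef] at hEW1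
  rw [hLgdef] at hLg0
  have hEW0 : 0 < EW := by linarith
  -- the denominator is `(EW · Lg)^m`
  have hden : ((W : ℝ) * Lg / (W.totient : ℝ)) = EW * Lg := by
    rw [← hEWdef, hW, eulerFactorProd_one_primeFactors hW0]; ring
  have hden' : (W : ℝ) / (W.totient : ℝ) * Lg = EW * Lg := by rw [← hden]; ring
  rw [hW, hLgdef, hden'] at hδ
  have hMain0 : 0 < (EW * Lg) ^ m := by positivity
  have hMainLg : Lg ^ m ≤ (EW * Lg) ^ m := by
    rw [mul_pow]
    exact le_mul_of_one_le_left (by positivity) (one_le_pow₀ hEW1)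
  -- the local density system
  have hω : IsLocalDensitySystem m R W (fun p X => localDensity₀ p W L b X) := by
    rw [← hW]; exact isLocalDensitySystem_localDensity R L hLC hCw hL0 hLp b
  -- (i) the box error
  have h1 : |(𝔼 x ∈ Fintype.piFinset (fun j => Ico (a j) (a j + ℓ j)),
        ∏ i, truncatedDivisorSum R (W * (∑ j, L i j * x j + b i) + 1) ^ 2) -
      correlationSum m R (fun p X => localDensity₀ p W L b X)| ≤ (n + 1) * Lg ^ (2 * m) / R ^ (6 * m) := by
    have hℓ' : ∀ j, R ^ (2 * m) ≤ ℓ j := fun j =>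
      le_trans (pow_le_pow_right₀ hR1' (by omega)) (hℓ j)
    refine (abs_expect_sub_correlationSum_le (m := m) hR1 W L b a ℓ hℓ').trans ?_
    rw [hLgdef]
    have hs := gy_sum_div_sides_le (m := m) hR1' ℓ hℓ
    calc Lg ^ (2 * m) * (R ^ (2 * m) * ∑ j, R ^ (2 * m) / (ℓ j : ℝ))
        ≤ Lg ^ (2 * m) * (R ^ (2 * m) * ((n + 1) * (R ^ (2 * m) / R ^ (10 * m)))) :=
          mul_le_mul_of_nonneg_left (mul_le_mul_of_nonneg_left hs (by positivity)) (by positivity)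
      _ = (n + 1) * Lg ^ (2 * m) / R ^ (6 * m) := by
          have hR4 : R ^ (10 * m) = R ^ (4 * m) * R ^ (6 * m) := by rw [← pow_add]; ring_nf
          have hR2 : R ^ (4 * m) = R ^ (2 * m) * R ^ (2 * m) := by rw [← pow_add]; ring_nf
          rw [hR4, hR2]
          have : R ^ (2 * m) ≠ 0 := pow_ne_zero _ hR0.ne'
          have : R ^ (6 * m) ≠ 0 := pow_ne_zero _ hR0.ne'
          field_simp
  -- (ii) the comparison with `S^m`
  have h2 : |correlationSum m R (fun p X => localDensity₀ p W L b X) - selbergS W R ^ m| ≤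
      (C₀ ^ 2 * EW ^ 2 * (Real.exp 5 * Lg)) ^ m * (2 * (16 : ℝ) ^ m / w) := by
    have h := abs_correlationSum_sub_pow_le hω hW0 hC₀
    rw [← hW, hEWdef, hW] at h
    refine h.trans ?_
    have hG : ∑ r ∈ (Finset.Icc 1 ⌊R⌋₊).filter Squarefree, 1 / (r.totient : ℝ) ≤ Real.exp 5 * Lg := by
      have hB2 : 2 ≤ ⌊R⌋₊ := Nat.le_floor (by exact_mod_cast hR)
      refine (sum_sq_moebius_div_totient_le ⌊R⌋₊).trans ((eulerFactorProd_primesBelow_le_log hB2).trans ?_)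
      rw [← hLgdef]
      exact mul_le_mul_of_nonneg_left (Real.log_le_log (by positivity) (Nat.floor_le hR0.le)) (Real.exp_pos _).le
    have hG0 : 0 ≤ ∑ r ∈ (Finset.Icc 1 ⌊R⌋₊).filter Squarefree, 1 / (r.totient : ℝ) :=
      sum_nonneg fun r _ => by positivity
    have hprod : ∏ p ∈ (primesUpTo R).filter (fun p => ¬p ∣ W), (1 + (16 : ℝ) ^ m / (p : ℝ) ^ 2) - 1 ≤
        2 * (16 : ℝ) ^ m / w := by
      refine prod_one_add_div_sq_sub_one_le (by omega) (by positivity) hw16 _ fun p hp => ?_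
      have hpr : p.Prime := prime_of_mem_primesUpTo (mem_filter.1 hp).1
      refine lt_of_not_ge fun h => (mem_filter.1 hp).2 ?_
      rw [← hW]; exact (hpr.dvd_primorial_iff).2 h
    have hprod0 : 0 ≤ ∏ p ∈ (primesUpTo R).filter (fun p => ¬p ∣ W), (1 + (16 : ℝ) ^ m / (p : ℝ) ^ 2) - 1 := by
      rw [sub_nonneg]
      calc (1 : ℝ) = ∏ _p ∈ (primesUpTo R).filter (fun p => ¬p ∣ W), (1 : ℝ) := by simp
        _ ≤ _ := prod_le_prod (fun _ _ => zero_le_one) fun p _ => le_add_of_nonneg_right (by positivity)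
    have hK : C₀ ^ 2 * EW ^ 2 * ∑ r ∈ (Finset.Icc 1 ⌊R⌋₊).filter Squarefree, 1 / (r.totient : ℝ) ≤
        C₀ ^ 2 * EW ^ 2 * (Real.exp 5 * Lg) := mul_le_mul_of_nonneg_left hG (by positivity)
    have hK0 : 0 ≤ C₀ ^ 2 * EW ^ 2 * ∑ r ∈ (Finset.Icc 1 ⌊R⌋₊).filter Squarefree, 1 / (r.totient : ℝ) := by
      positivity
    exact mul_le_mul (pow_le_pow_left₀ hK0 hK m) hprod hprod0 (by positivity)
  -- (iii) the `m`-th power of the `m = 1` relative error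
  have h3 : |selbergS W R ^ m / (EW * Lg) ^ m - 1| ≤ (2 ^ m - 1) * δ := by
    rw [← div_pow]
    exact abs_pow_sub_one_le_of_abs_sub_one_le hδ hδ1 m
  -- combination
  rw [hW, hLgdef, hden]
  set E := 𝔼 x ∈ Fintype.piFinset (fun j => Ico (a j) (a j + ℓ j)),
    ∏ i, truncatedDivisorSum R (W * (∑ j, L i j * x j + b i) + 1) ^ 2 with hE
  set T := correlationSum m R (fun p X => localDensity₀ p W L b X) with hT
  set S := selbergS W R with hS
  have hsplit : E / (EW * Lg) ^ m - 1 =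
      (E - T) / (EW * Lg) ^ m + (T - S ^ m) / (EW * Lg) ^ m + (S ^ m / (EW * Lg) ^ m - 1) := by
    field_simp
    ring
  rw [hsplit]
  have hEWle : EW ≤ Real.exp 5 * Real.log w := by
    rw [← hEWdef]; exact eulerFactorProd_primorial_le_log hw2
  -- term (i)
  have t1 : |(E - T) / (EW * Lg) ^ m| ≤ (n + 1) * Lg ^ m / R ^ (6 * m) := by
    rw [abs_div, abs_of_pos hMain0]
    calc |E - T| / (EW * Lg) ^ m ≤ |E - T| / Lg ^ m :=
          div_le_div_of_nonneg_left (abs_nonneg _) (by positivity) hMainLg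
      _ ≤ ((n + 1) * Lg ^ (2 * m) / R ^ (6 * m)) / Lg ^ m := div_le_div_of_nonneg_right h1 (by positivity)
      _ = (n + 1) * Lg ^ m / R ^ (6 * m) := by
          have : Lg ^ (2 * m) = Lg ^ m * Lg ^ m := by rw [← pow_add]; ring_nf
          rw [this]
          have : Lg ^ m ≠ 0 := pow_ne_zero _ hLg0.ne'
          field_simp
  -- term (ii)
  have t2 : |(T - S ^ m) / (EW * Lg) ^ m| ≤ 2 * (16 * C₀ ^ 2 * Real.exp 5 * (Real.exp 5 * Real.log w)) ^ m / w := by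
    rw [abs_div, abs_of_pos hMain0, div_le_iff₀ hMain0]
    refine h2.trans ?_
    have hid : (C₀ ^ 2 * EW ^ 2 * (Real.exp 5 * Lg)) ^ m * (2 * (16 : ℝ) ^ m / w) =
        2 * (16 * C₀ ^ 2 * Real.exp 5 * EW) ^ m / w * (EW * Lg) ^ m := by
      rw [show C₀ ^ 2 * EW ^ 2 * (Real.exp 5 * Lg) = (C₀ ^ 2 * Real.exp 5 * EW) * (EW * Lg) by ring, mul_pow,
        show (16 : ℝ) * C₀ ^ 2 * Real.exp 5 * EW = 16 * (C₀ ^ 2 * Real.exp 5 * EW) by ring, mul_pow]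
      ring
    rw [hid]
    refine mul_le_mul_of_nonneg_right ?_ hMain0.le
    refine div_le_div_of_nonneg_right (mul_le_mul_of_nonneg_left ?_ (by norm_num)) hw0.le
    exact pow_le_pow_left₀ (by positivity) (mul_le_mul_of_nonneg_left hEWle (by positivity)) m
  calc |(E - T) / (EW * Lg) ^ m + (T - S ^ m) / (EW * Lg) ^ m + (S ^ m / (EW * Lg) ^ m - 1)|
      ≤ |(E - T) / (EW * Lg) ^ m| + |(T - S ^ m) / (EW * Lg) ^ m| + |S ^ m / (EW * Lg) ^ m - 1| :=
        (abs_add_le _ _).trans (add_le_add (abs_add_le _ _) le_rfl)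
    _ ≤ (n + 1) * Lg ^ m / R ^ (6 * m) + 2 * (16 * C₀ ^ 2 * Real.exp 5 * (Real.exp 5 * Real.log w)) ^ m / w +
          (2 ^ m - 1) * δ := add_le_add (add_le_add t1 t2) h3
    _ = _ := by ring

/-! ### Proposition 9.5 -/

/-- An integer of absolute value at most `x` has absolute value at most `⌊x⌋`. [folklore] -/
theorem gy_int_abs_le_floor {z : ℤ} {x : ℝ} (h : (|z| : ℝ) ≤ x) : |z| ≤ (⌊x⌋₊ : ℤ) := by
  have h0 : 0 ≤ |z| := abs_nonneg z
  have h' : ((|z| : ℤ) : ℝ) ≤ x := by rw [Int.cast_abs]; exact h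
  have hcast : (((|z|).toNat : ℕ) : ℝ) = ((|z| : ℤ) : ℝ) := by
    rw [← Int.cast_natCast, Int.toNat_of_nonneg h0]
  have h1 : (((|z|).toNat : ℕ) : ℝ) ≤ x := by rw [hcast]; exact h'
  have h2 : (|z|).toNat ≤ ⌊x⌋₊ := Nat.le_floor h1
  calc |z| = ((|z|).toNat : ℤ) := (Int.toNat_of_nonneg h0).symm
    _ ≤ (⌊x⌋₊ : ℤ) := by exact_mod_cast h2

/-- **Green–Tao 2008, Proposition 9.5 (Goldston–Yıldırım), proved.** Discharge of the named fact
`GoldstonYildirimLinearForms` of `GreenTao2008Majorant`, with the growth bound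
`G(N) = ⌊log log log R⌋`, `R = N^{k⁻¹2^{-k-4}}`. [cite: GreenTaoAnnals2008, Proposition 9.5] -/
theorem GoldstonYildirimLinearForms_holds : GoldstonYildirimLinearForms := by
  intro k m t hk hm ht
  obtain ⟨n, rfl⟩ : ∃ n, t = n + 1 := ⟨t - 1, by omega⟩
  obtain ⟨C₀, hC0, hC₀⟩ := exists_abs_moebiusLogSum_le
  -- `R_N → ∞`
  have hRt : Tendsto (fun N : ℕ => gyLevel k N) atTop atTop := by
    have hc : 0 < (k : ℝ)⁻¹ * 2⁻¹ ^ (k + 4) := by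
      have : (0 : ℝ) < k := by exact_mod_cast (by omega : 0 < k)
      positivity
    exact (tendsto_rpow_atTop hc).comp tendsto_natCast_atTop_atTop
  -- the growth function
  refine ⟨fun N => ⌊Real.log (Real.log (Real.log (gyLevel k N)))⌋₊, ?_, ?_⟩
  · exact tendsto_nat_floor_atTop.comp (Real.tendsto_log_atTop.comp
      (Real.tendsto_log_atTop.comp (Real.tendsto_log_atTop.comp hRt)))
  intro w hw hwG ε hε
  -- the `m = 1` asymptotic with relative error `δ`
  obtain ⟨δ, hδpos, hδ1, hδε⟩ : ∃ δ : ℝ, 0 < δ ∧ δ ≤ 1 ∧ (2 ^ m - 1) * δ ≤ ε / 3 := by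
    refine ⟨min 1 (ε / (3 * 2 ^ m)), lt_min one_pos (by positivity), min_le_left _ _, ?_⟩
    have h2m : (1 : ℝ) ≤ 2 ^ m := one_le_pow₀ (by norm_num)
    calc (2 ^ m - 1) * min 1 (ε / (3 * 2 ^ m)) ≤ 2 ^ m * (ε / (3 * 2 ^ m)) :=
          mul_le_mul (by linarith) (min_le_right _ _) (le_min zero_le_one (by positivity)) (by positivity)
      _ = ε / 3 := by field_simp
  obtain ⟨R₀, w₀, hasymp⟩ := selbergS_primorial_asymptotic δ hδpos
  -- the comparison error `2 (A log v)^m / v → 0` in the variable `v = w(N)`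
  have hwlim : Tendsto (fun v : ℕ => 2 * (16 * C₀ ^ 2 * Real.exp 5 * (Real.exp 5 * Real.log v)) ^ m / v)
      atTop (𝓝 0) := by
    have h := (Real.tendsto_pow_log_div_mul_add_atTop 1 0 m one_ne_zero).comp tendsto_natCast_atTop_atTop
    have h2 : Tendsto (fun v : ℕ => 2 * (16 * C₀ ^ 2 * Real.exp 5 * Real.exp 5) ^ m *
        (Real.log v ^ m / (1 * v + 0))) atTop (𝓝 (2 * (16 * C₀ ^ 2 * Real.exp 5 * Real.exp 5) ^ m * 0)) :=
      Tendsto.const_mul _ h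
    rw [mul_zero] at h2
    refine h2.congr fun v => ?_
    rw [one_mul, add_zero, show (16 : ℝ) * C₀ ^ 2 * Real.exp 5 * (Real.exp 5 * Real.log v) =
      (16 * C₀ ^ 2 * Real.exp 5 * Real.exp 5) * Real.log v by ring, mul_pow]
    ring
  -- the box error `(n+1) (log R)^m / R → 0`
  have hRlim : Tendsto (fun N : ℕ => ((n : ℝ) + 1) * (Real.log (gyLevel k N) ^ m / (1 * gyLevel k N + 0))) atTop
      (𝓝 (((n : ℝ) + 1) * 0)) :=
    Tendsto.const_mul _ ((Real.tendsto_pow_log_div_mul_add_atTop 1 0 m one_ne_zero).comp hRt)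
  rw [mul_zero] at hRlim
  -- collect the thresholds
  have hε3 : 0 < ε / 3 := by linarith
  filter_upwards [hRt.eventually (eventually_ge_atTop (max R₀ (max 16 (Real.exp (Real.exp 1))))),
    hw.eventually (eventually_ge_atTop (max w₀ (max 2 ⌈(16 : ℝ) ^ m⌉₊))),
    (hwlim.comp hw).eventually (ge_mem_nhds hε3), hRlim.eventually (ge_mem_nhds hε3)] with N hRN hwN hT2 hT3
  intro _ L hL hL0 hLp b a ℓ hℓ
  -- unpack the thresholds
  have hRR₀ : R₀ ≤ gyLevel k N := le_trans (le_max_left _ _) hRN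
  have hR16 : (16 : ℝ) ≤ gyLevel k N := le_trans ((le_max_left _ _).trans (le_max_right _ _)) hRN
  have hRee : Real.exp (Real.exp 1) ≤ gyLevel k N := le_trans ((le_max_right _ _).trans (le_max_right _ _)) hRN
  have hR2 : (2 : ℝ) ≤ gyLevel k N := by linarith
  have hR0 : 0 < gyLevel k N := by linarith
  have hww₀ : w₀ ≤ w N := le_trans (le_max_left _ _) hwN
  have hw2 : 2 ≤ w N := le_trans ((le_max_left _ _).trans (le_max_right _ _)) hwN
  have hw16 : (16 : ℝ) ^ m ≤ w N := by
    have : ⌈(16 : ℝ) ^ m⌉₊ ≤ w N := le_trans ((le_max_right _ _).trans (le_max_right _ _)) hwN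
    exact (Nat.le_ceil _).trans (by exact_mod_cast this)
  -- the link `exp(exp w) ≤ log R` from `w ≤ G(N)`
  have hlogR : Real.exp 1 ≤ Real.log (gyLevel k N) := by
    rw [Real.le_log_iff_exp_le hR0]; exact hRee
  have hlogR0 : 0 < Real.log (gyLevel k N) := lt_of_lt_of_le (Real.exp_pos 1) hlogR
  have hloglog : 1 ≤ Real.log (Real.log (gyLevel k N)) := by
    rw [Real.le_log_iff_exp_le hlogR0]; exact hlogR
  have hloglog0 : 0 < Real.log (Real.log (gyLevel k N)) := by linarith
  have hℓ₃ : 0 ≤ Real.log (Real.log (Real.log (gyLevel k N))) := Real.log_nonneg hloglog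
  have hlink : Real.exp (Real.exp (w N)) ≤ Real.log (gyLevel k N) := by
    have h1 : (w N : ℝ) ≤ Real.log (Real.log (Real.log (gyLevel k N))) :=
      le_trans (by exact_mod_cast hwG N) (Nat.floor_le hℓ₃)
    have h2 : Real.exp (w N) ≤ Real.log (Real.log (gyLevel k N)) := by
      calc Real.exp (w N) ≤ Real.exp (Real.log (Real.log (Real.log (gyLevel k N)))) := Real.exp_le_exp.2 h1
        _ = Real.log (Real.log (gyLevel k N)) := Real.exp_log hloglog0
    calc Real.exp (Real.exp (w N)) ≤ Real.exp (Real.log (Real.log (gyLevel k N))) := Real.exp_le_exp.2 h2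
      _ = Real.log (gyLevel k N) := Real.exp_log hlogR0
  -- the `m = 1` relative error
  have hδ' := hasymp (gyLevel k N) hRR₀ (w N) hww₀ hlink
  -- the coefficient bound as an integer
  set C : ℕ := ⌊Real.sqrt (w N) / 2⌋₊ with hC
  have hLC : ∀ i j, |L i j| ≤ C := fun i j => gy_int_abs_le_floor (hL i j)
  have hCw : 2 * C ^ 2 ≤ w N := by
    have hw0 : (0 : ℝ) ≤ w N := Nat.cast_nonneg _
    have hCr : (C : ℝ) ≤ Real.sqrt (w N) / 2 := Nat.floor_le (by positivity)
    have hC0 : (0 : ℝ) ≤ C := Nat.cast_nonneg _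
    have hsq : (C : ℝ) ^ 2 ≤ (w N : ℝ) / 4 := by
      calc (C : ℝ) ^ 2 ≤ (Real.sqrt (w N) / 2) ^ 2 := pow_le_pow_left₀ hC0 hCr 2
        _ = (w N : ℝ) / 4 := by rw [div_pow, Real.sq_sqrt hw0]; norm_num
    have : (2 * C ^ 2 : ℕ) ≤ (w N : ℝ) := by push_cast; linarith
    exact_mod_cast this
  -- the estimate at level `R = R_N`
  have hcore := linearForms_core hC₀ hR2 hw2 hw16 hδ' hδ1 L hLC hCw hL0 hLp b a ℓ hℓ
  refine hcore.trans ?_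
  -- the three terms are `≤ ε/3`
  have hT2' : 2 * (16 * C₀ ^ 2 * Real.exp 5 * (Real.exp 5 * Real.log (w N))) ^ m / (w N) ≤ ε / 3 := by
    simpa [Function.comp] using hT2
  have hT3' : ((n : ℝ) + 1) * Real.log (gyLevel k N) ^ m / gyLevel k N ^ (6 * m) ≤ ε / 3 := by
    refine le_trans ?_ hT3
    rw [one_mul, add_zero, mul_div_assoc]
    refine mul_le_mul_of_nonneg_left ?_ (by positivity)
    refine div_le_div_of_nonneg_left (by positivity) hR0 ?_
    calc gyLevel k N = gyLevel k N ^ 1 := (pow_one _).symm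
      _ ≤ gyLevel k N ^ (6 * m) := pow_le_pow_right₀ (by linarith) (by omega)
  linarith

end Literature.NumberTheory.Sieve.GreenTao2008
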